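import Summits.Ventures.CertifiedArithmetic.LowPrec.Accumulate

/-!
# Deleting an absorbed term does not change a sequential floating-point sum

HONEST FRAMING (venture CertifiedArithmetic / cell `pub-lowprec`, seat gemm, gen 4): certified error
envelopes and provably optimal rounding/accumulation schemes for low-precision formats under stated
cost models; every table by two implementations; no hardware or vendor claims.

Paper `gemm.tex` §Regimes, the deletion step in the proofs of the terminal-regime and range theorems,
kernel-checked for every format and every rounding outcome: if the term `x (j₀+1)` is ABSORBED —
`ŝ_{j₀+1} = ŝ_{j₀}` as values — then the sequence with that term deleted (`delAt x (j₀+1)`) has the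
same computed partial sums from there on, shifted by one index (`seqSum_delAt`), while its exact sum
and its mass lose exactly `x (j₀+1)` resp. `|x (j₀+1)|` (`sum_delAt`, `sum_abs_delAt`).  Hence the
gain `ŝ - Σ x` of the shortened input is the old gain PLUS the deleted term and the deficit is
unchanged when the deleted term is `≤ 0` ("gainful" and "null" absorptions) — the bookkeeping
`G(ω') = G(ω) - c_e`, `D(ω') = D(ω)` of the paper (`gain_delAt`).
-/

namespace Literature.ComputerArithmetic.FloatingPoint

namespace MiniFloat

open Finset

variable {α : Format}

/-- The sequence `x` with the term of index `j` deleted (later terms move up). [folklore] -/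
def delAt (x : ℕ → ℚ) (j : ℕ) : ℕ → ℚ := fun i => if i < j then x i else x (i + 1)

/-- Terms before the deleted index are unchanged. [folklore] -/
theorem delAt_of_lt (x : ℕ → ℚ) {j i : ℕ} (h : i < j) : delAt x j i = x i := by
  simp [delAt, h]

/-- Terms from the deleted index on are the old terms one index later. [folklore] -/
theorem delAt_of_le (x : ℕ → ℚ) {j i : ℕ} (h : j ≤ i) : delAt x j i = x (i + 1) := by
  simp [delAt, Nat.not_lt.mpr h]

/-- Before the deleted index nothing changes. [folklore] -/
theorem seqSum_delAt_of_lt (x : ℕ → ℚ) (j : ℕ) : ∀ k, k < j → seqSum α (delAt x j) k = seqSum α x k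
  | 0, h => by simp only [seqSum, delAt_of_lt x h]
  | k + 1, h => by
      simp only [seqSum, seqSum_delAt_of_lt x j k (Nat.lt_of_succ_lt h), delAt_of_lt x h]

/-- DELETION OF AN ABSORBED TERM: if `ŝ_{j₀+1} = ŝ_{j₀}` (the term `x (j₀+1)` left the accumulator
unchanged), then the shortened input has the same computed sums, one index earlier:
`ŝ'_{j₀+t} = ŝ_{j₀+t+1}` for every `t`. [folklore] -/
theorem seqSum_delAt (x : ℕ → ℚ) (j₀ : ℕ)
    (habs : (seqSum α x (j₀ + 1)).toRat = (seqSum α x j₀).toRat) :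
    ∀ t, (seqSum α (delAt x (j₀ + 1)) (j₀ + t)).toRat = (seqSum α x (j₀ + t + 1)).toRat
  | 0 => by
      show (seqSum α (delAt x (j₀ + 1)) j₀).toRat = (seqSum α x (j₀ + 1)).toRat
      rw [seqSum_delAt_of_lt x (j₀ + 1) j₀ (Nat.lt_succ_self j₀), habs]
  | t + 1 => by
      have ih := seqSum_delAt x j₀ habs t
      rw [show j₀ + (t + 1) = (j₀ + t) + 1 from rfl, seqSum, seqSum, ih,
        delAt_of_le x (by omega : j₀ + 1 ≤ j₀ + t + 1)]

/-- The exact sum of the shortened input: `Σ_{i ≤ j₀+t} x'_i = Σ_{i ≤ j₀+t+1} x_i - x_{j₀+1}`.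
[folklore] -/
theorem sum_delAt (x : ℕ → ℚ) (j₀ : ℕ) :
    ∀ t, ∑ i ∈ range (j₀ + t + 1), delAt x (j₀ + 1) i = ∑ i ∈ range (j₀ + t + 2), x i - x (j₀ + 1)
  | 0 => by
      show ∑ i ∈ range (j₀ + 1), delAt x (j₀ + 1) i = ∑ i ∈ range (j₀ + 1 + 1), x i - x (j₀ + 1)
      rw [sum_range_succ (fun i => x i) (j₀ + 1), add_sub_cancel_right]
      exact Finset.sum_congr rfl fun i hi => delAt_of_lt x (Finset.mem_range.mp hi)
  | t + 1 => by
      rw [show j₀ + (t + 1) + 1 = (j₀ + t + 1) + 1 from rfl, sum_range_succ, sum_delAt x j₀ t,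
        show j₀ + (t + 1) + 2 = (j₀ + t + 2) + 1 from rfl, sum_range_succ (fun i => x i) (j₀ + t + 2),
        delAt_of_le x (by omega : j₀ + 1 ≤ j₀ + t + 1)]
      ring

/-- The mass of the shortened input: `Σ_{i ≤ j₀+t} |x'_i| = Σ_{i ≤ j₀+t+1} |x_i| - |x_{j₀+1}|`.
[folklore] -/
theorem sum_abs_delAt (x : ℕ → ℚ) (j₀ : ℕ) (t : ℕ) :
    ∑ i ∈ range (j₀ + t + 1), |delAt x (j₀ + 1) i| = ∑ i ∈ range (j₀ + t + 2), |x i| - |x (j₀ + 1)| := by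
  have h := sum_delAt (fun i => |x i|) j₀ t
  have hc : ∀ i, |delAt x (j₀ + 1) i| = delAt (fun i => |x i|) (j₀ + 1) i := by
    intro i; by_cases hi : i < j₀ + 1
    · rw [delAt_of_lt x hi, delAt_of_lt (fun i => |x i|) hi]
    · rw [delAt_of_le x (Nat.not_lt.mp hi), delAt_of_le (fun i => |x i|) (Nat.not_lt.mp hi)]
  rw [Finset.sum_congr rfl fun i _ => hc i, h]

/-- GAIN BOOKKEEPING of the deletion step (paper: `G(ω') = G(ω) + p_j`): the gain of the shortened
input at index `j₀+t` equals the gain of the original at `j₀+t+1` plus the deleted term. [folklore] -/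
theorem gain_delAt (x : ℕ → ℚ) (j₀ : ℕ)
    (habs : (seqSum α x (j₀ + 1)).toRat = (seqSum α x j₀).toRat) (t : ℕ) :
    (seqSum α (delAt x (j₀ + 1)) (j₀ + t)).toRat - ∑ i ∈ range (j₀ + t + 1), delAt x (j₀ + 1) i
      = ((seqSum α x (j₀ + t + 1)).toRat - ∑ i ∈ range (j₀ + t + 2), x i) + x (j₀ + 1) := by
  rw [seqSum_delAt x j₀ habs t, sum_delAt x j₀ t]; ring

end MiniFloat

end Literature.ComputerArithmetic.FloatingPoint
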